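import Mathlib
import HarnessLib

/-!
# Hermite's root-counting criterion: a positive definite Hankel matrix of Newton sums forces
# real, simple roots (and conversely)

Topic `LinearAlgebra/Matrix`; **proof file** (one definition with body + theorems; no named facts).

Let `P ∈ ℝ[X]` be monic of degree `p` with complex roots `x₁, …, x_p` (listed with multiplicity)
and Newton sums `N_m = Σ_i x_i^m`.  Hermite's quadratic form is
`Her(P,1)(f) = Σ_i (f₁ + f₂ x_i + ⋯ + f_p x_i^{p-1})²`, whose matrix in the basis `1, X, …, X^{p-1}`
is the Hankel matrix `Newt₀(P) = (N_{j+k})_{0 ≤ j,k < p}`.  Basu–Pollack–Roy, *Algorithms in Real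
Algebraic Geometry*, §4.3.2, Theorem 4.57 [Hermite] / Theorem 4.58: **the rank of `Her(P,1)` is the
number of distinct complex roots of `P` and its signature is the number of distinct real roots.**
In particular `Newt₀(P)` is positive definite iff `P` has `p` distinct roots, all of them real.

This file proves exactly that corollary, in the form used by finite-level "local Riemann
hypothesis" certificates (a rational Hankel matrix of power sums is tested for positive
definiteness and the verdict is read as "all zeros real and simple"):

* `newtonHankel α` — the Hankel matrix `(Σ_i α_i^{j+k})_{j,k}` of a tuple `α : Fin n → R`, and
  `newtonHankel_eq_transpose_mul` : it equals `Vᵀ V` for the Vandermonde matrix `V` of `α`, whence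
  `dotProduct_newtonHankel_mulVec` : `uᵀ · newtonHankel α · u = Σ_i ((V u)_i)²` (Hermite's form);
* `im_eq_zero_and_injective_of_posDef` — if `α : Fin n → ℂ` is closed under complex conjugation
  (as the roots-with-multiplicity of a real polynomial are) and the real matrix `H` with
  `H j k = Σ_i α_i^{j+k}` is positive definite, then every `α_i` is real and the `α_i` are pairwise
  distinct (the printed Vandermonde argument: `det H = (det V)² ≠ 0` gives distinctness; for a
  non-real `α_m` the real vector `u` with `V u = i·e_m − i·e_{σ m}` has `uᵀ H u = −2 < 0`);
* `posDef_newtonHankel_of_injective` — conversely, for pairwise distinct real `α_i` the matrix is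
  positive definite (`uᵀ H u = ‖V u‖² > 0` since `V` is invertible);
* `roots_im_eq_zero_and_nodup_of_posDef` — the statement for a real polynomial `p` of degree `n`:
  if the Hankel matrix of the Newton sums of its complex roots (with multiplicity) is positive
  definite, every complex root is real and `roots` has no repetition (the root multiset of a real
  polynomial is conjugation-closed, `Polynomial.roots_map_of_injective_of_card_eq_natDegree`).

## References

* [BasuPollackRoy2006] S. Basu, R. Pollack, M.-F. Roy, *Algorithms in Real Algebraic Geometry*,
  2nd ed., Algorithms and Computation in Mathematics 10, Springer (2006), doi:10.1007/3-540-33099-2,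
  §4.3.2 "Hermite's Quadratic Form", Theorem 4.57 [Hermite] and Theorem 4.58 with proof
  (read at page: held copy `book:basu2006-algorithms-real-algebraic-geometry`, chunks p0169–p0172).
* Origin: C. Hermite, *Extrait d'une lettre … sur le nombre des racines d'une équation algébrique
  comprises entre des limites données*, J. reine angew. Math. 52 (1856) 39–51 (not re-read; cited
  through [BasuPollackRoy2006]).

## Mathlib / tree search

No prior formalisation (`lean search 'Hankel' / 'real_roots|roots_real' / 'Sturm' --decl`,
2026-08-20: only unrelated Hankel ladders). Used: `Matrix.vandermonde`,
`Matrix.det_vandermonde_ne_zero_iff`, `Matrix.PosDef.isUnit`, `Matrix.posDef_iff_dotProduct_mulVec`,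
`Matrix.PosDef.of_dotProduct_mulVec_pos`, `Matrix.mulVec_injective_iff_isUnit`,
`Matrix.dotProduct_star_self_pos_iff`, `RingHom.map_det`.
-/

open Matrix Finset Complex

namespace Literature.LinearAlgebra.Matrix

namespace HermiteRootCounting

variable {n : ℕ}

/-- The Hankel matrix of Newton (power) sums `(Σ_i α_i^{j+k})_{0 ≤ j,k < n}` of a tuple
`α : Fin n → R` — the matrix `Newt₀(P)` of Hermite's quadratic form `Her(P,1)` when `α` lists the
roots of `P` with multiplicity. [cite: BasuPollackRoy2006, §4.3.2 (display before Prop. 4.53)] -/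
def newtonHankel {R : Type*} [CommRing R] (α : Fin n → R) : Matrix (Fin n) (Fin n) R :=
  Matrix.of fun j k => ∑ i, α i ^ ((j : ℕ) + (k : ℕ))

/-- Entries of `Newt₀`: the Newton sums `N_{j+k}`. [cite: BasuPollackRoy2006, §4.3.2, Remark 4.56] -/
theorem newtonHankel_apply {R : Type*} [CommRing R] (α : Fin n → R) (j k : Fin n) :
    newtonHankel α j k = ∑ i, α i ^ ((j : ℕ) + (k : ℕ)) := rfl

/-- `Newt₀ = Vᵀ V` for the Vandermonde matrix `V_{ij} = α_i^j`.
[cite: BasuPollackRoy2006, §4.3.2, proof of Theorem 4.57] -/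
theorem newtonHankel_eq_transpose_mul {R : Type*} [CommRing R] (α : Fin n → R) :
    newtonHankel α = (vandermonde α)ᵀ * vandermonde α := by
  ext j k
  simp only [newtonHankel, of_apply, mul_apply, transpose_apply, vandermonde_apply, pow_add]

/-- Hermite's form: `uᵀ Newt₀ u = Σ_i (u₀ + u₁ α_i + ⋯ + u_{n-1} α_i^{n-1})²`.
[cite: BasuPollackRoy2006, §4.3.2, definition of Her(P,1)] -/
theorem dotProduct_newtonHankel_mulVec {R : Type*} [CommRing R] (α : Fin n → R)
    (u : Fin n → R) :
    u ⬝ᵥ (newtonHankel α *ᵥ u) = (vandermonde α *ᵥ u) ⬝ᵥ (vandermonde α *ᵥ u) := by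
  rw [newtonHankel_eq_transpose_mul, ← mulVec_mulVec, dotProduct_mulVec, vecMul_transpose]

/-- The determinant of the Newton–Hankel matrix is the square of the Vandermonde determinant
(the non-degeneracy step of Hermite's proof: the linear forms `L(x_i, ·)` are independent iff the
roots are distinct). [cite: BasuPollackRoy2006, §4.3.2, proof of Theorem 4.57] -/
theorem det_newtonHankel {R : Type*} [CommRing R] (α : Fin n → R) :
    (newtonHankel α).det = (vandermonde α).det ^ 2 := by
  rw [newtonHankel_eq_transpose_mul, det_mul, det_transpose, sq]

/-- **Hermite's criterion, positive-definite case** (the direction used to read a finite-level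
certificate): let `α : Fin n → ℂ` be closed under complex conjugation via a permutation `σ`
(e.g. the roots, with multiplicity, of a real polynomial), and let `H` be the real matrix with
`H j k = Σ_i α_i^{j+k}` (the Newton sums are real).  If `H` is positive definite then every
`α_i` is real and the `α_i` are pairwise distinct — i.e. "all roots real and simple".
[cite: BasuPollackRoy2006, §4.3.2, Theorem 4.57 [Hermite] / Theorem 4.58] -/
theorem im_eq_zero_and_injective_of_posDef (α : Fin n → ℂ) (σ : Equiv.Perm (Fin n))
    (hσ : ∀ i, α (σ i) = starRingEnd ℂ (α i)) (H : Matrix (Fin n) (Fin n) ℝ)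
    (hH : ∀ j k, ((H j k : ℝ) : ℂ) = ∑ i, α i ^ ((j : ℕ) + (k : ℕ))) (hpos : H.PosDef) :
    (∀ i, (α i).im = 0) ∧ Function.Injective α := by
  classical
  -- the complexified matrix is the Newton–Hankel matrix of `α`
  have hmap : H.map ((↑) : ℝ → ℂ) = newtonHankel α := by
    ext j k; simp [hH, newtonHankel_apply]
  -- (1) distinctness from `det H ≠ 0`
  have hdetH : H.det ≠ 0 := by
    have hu : IsUnit H := hpos.isUnit
    exact ((Matrix.isUnit_iff_isUnit_det H).mp hu).ne_zero
  have hdetV : (vandermonde α).det ≠ 0 := by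
    have h1 : (newtonHankel α).det ≠ 0 := by
      rw [← hmap]
      have : (H.map ((↑) : ℝ → ℂ)).det = ((H.det : ℝ) : ℂ) := by
        change (H.map ⇑Complex.ofRealHom).det = Complex.ofRealHom H.det
        rw [RingHom.map_det Complex.ofRealHom H]
        rfl
      rw [this]; exact_mod_cast hdetH
    rw [det_newtonHankel] at h1
    exact fun h => h1 (by rw [h]; ring)
  have hinj : Function.Injective α := det_vandermonde_ne_zero_iff.mp hdetV
  refine ⟨?_, hinj⟩
  -- (2) realness: `σ` is an involution moving every non-real index
  have hσσ : ∀ i, σ (σ i) = i := fun i => hinj (by rw [hσ, hσ, starRingEnd_self_apply])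
  by_contra hcon
  push Not at hcon
  obtain ⟨m, hm⟩ := hcon
  have hσm : σ m ≠ m := by
    intro h
    apply hm
    have : starRingEnd ℂ (α m) = α m := by rw [← hσ, h]
    exact Complex.conj_eq_iff_im.mp this
  -- the Vandermonde matrix is invertible
  set V : Matrix (Fin n) (Fin n) ℂ := vandermonde α with hVdef
  have hVunit : IsUnit V := (Matrix.isUnit_iff_isUnit_det V).mpr (isUnit_iff_ne_zero.mpr hdetV)
  have hVinj : Function.Injective V.mulVec := (Matrix.mulVec_injective_iff_isUnit).mpr hVunit
  -- target vector `t = i e_m - i e_{σ m}` and the solution `u` of `V u = t`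
  let t : Fin n → ℂ := fun i => if i = m then I else if i = σ m then -I else 0
  obtain ⟨u, hu⟩ : ∃ u : Fin n → ℂ, V *ᵥ u = t := by
    refine ⟨V⁻¹ *ᵥ t, ?_⟩
    rw [mulVec_mulVec, mul_nonsing_inv _ ((Matrix.isUnit_iff_isUnit_det V).mp hVunit), one_mulVec]
  -- `conj t (σ i) = t i`
  have ht : ∀ i, starRingEnd ℂ (t (σ i)) = t i := by
    intro i
    by_cases h1 : i = m
    · subst h1
      have : σ i ≠ i := hσm
      simp [t, this]
    · by_cases h2 : i = σ m
      · subst h2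
        simp [t, hσσ, h1]
      · have h3 : σ i ≠ m := fun h => h2 (by rw [← h, hσσ])
        have h4 : σ i ≠ σ m := fun h => h1 (σ.injective h)
        simp [t, h1, h2, h3, h4]
  -- `V (conj u) = t`, hence `conj u = u`: `u` is a real vector
  have hstar : V *ᵥ (star u) = t := by
    ext i
    have hi : (V *ᵥ u) (σ i) = t (σ i) := by rw [hu]
    simp only [mulVec, dotProduct, hVdef, vandermonde_apply] at hi ⊢
    rw [← ht i, ← hi, map_sum]
    refine Finset.sum_congr rfl fun j _ => ?_
    rw [map_mul, map_pow, ← hσ, hσσ, Pi.star_apply]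
    rfl
  have hreal : star u = u := hVinj (by rw [hstar, hu])
  have hur : ∀ j, ((u j).re : ℂ) = u j := fun j =>
    Complex.conj_eq_iff_re.mp (by simpa using congr_fun hreal j)
  let r : Fin n → ℝ := fun j => (u j).re
  have hr : ∀ j, ((r j : ℝ) : ℂ) = u j := hur
  have hr0 : r ≠ 0 := by
    intro h0
    have hu0 : u = 0 := by
      ext j; rw [← hr j]; simp [h0]
    have : t m = 0 := by rw [← hu, hu0, mulVec_zero]; rfl
    simp [t] at this
  -- Hermite's form at `u`: `Σ_i t_i² = -2`
  have hsum : u ⬝ᵥ (newtonHankel α *ᵥ u) = -2 := by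
    rw [dotProduct_newtonHankel_mulVec, ← hVdef, hu]
    have hsq : ∀ i, t i * t i = (if i = m then (-1 : ℂ) else 0) + (if i = σ m then (-1 : ℂ) else 0) := by
      intro i
      by_cases h1 : i = m
      · subst h1; simp [t, hσm.symm]
      · by_cases h2 : i = σ m
        · subst h2; simp [t, hσm]
        · simp [t, h1, h2]
    simp only [dotProduct, hsq, Finset.sum_add_distrib, Finset.sum_ite_eq', Finset.mem_univ,
      if_true]
    norm_num
  -- but positivity of `H` makes it a positive real number
  have hposr : 0 < r ⬝ᵥ (H *ᵥ r) := by
    simpa using hpos.dotProduct_mulVec_pos hr0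
  have hcast : ((r ⬝ᵥ (H *ᵥ r) : ℝ) : ℂ) = u ⬝ᵥ (newtonHankel α *ᵥ u) := by
    simp only [dotProduct, mulVec, Complex.ofReal_sum, Complex.ofReal_mul, hH, hr, newtonHankel_apply]
  have : ((r ⬝ᵥ (H *ᵥ r) : ℝ) : ℂ).re = -2 := by rw [hcast, hsum]; norm_num
  rw [Complex.ofReal_re] at this
  linarith

/-- **Converse**: pairwise distinct real `α_i` give a positive definite Newton–Hankel matrix
(`uᵀ Newt₀ u = ‖V u‖² > 0`, `V` invertible). [cite: BasuPollackRoy2006, §4.3.2, Theorem 4.58] -/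
theorem posDef_newtonHankel_of_injective (α : Fin n → ℝ) (hinj : Function.Injective α) :
    (newtonHankel α).PosDef := by
  classical
  refine Matrix.PosDef.of_dotProduct_mulVec_pos ?_ fun x hx => ?_
  · -- symmetric real matrix
    rw [Matrix.IsHermitian, conjTranspose, newtonHankel]
    ext j k
    simp [add_comm]
  · have hdet : (vandermonde α).det ≠ 0 := det_vandermonde_ne_zero_iff.mpr hinj
    have hVunit : IsUnit (vandermonde α) :=
      (Matrix.isUnit_iff_isUnit_det _).mpr (isUnit_iff_ne_zero.mpr hdet)
    have hVinj : Function.Injective (vandermonde α).mulVec :=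
      (Matrix.mulVec_injective_iff_isUnit).mpr hVunit
    have hne : vandermonde α *ᵥ x ≠ 0 := by
      intro h; exact hx (hVinj (by rw [h, mulVec_zero]))
    rw [star_trivial, dotProduct_newtonHankel_mulVec]
    have := Matrix.dotProduct_star_self_pos_iff.mpr hne
    simpa using this

/-- Packaging both directions for a conjugation-closed complex tuple: the real Newton–Hankel
matrix is positive definite **iff** all `α_i` are real and pairwise distinct.
[cite: BasuPollackRoy2006, §4.3.2, Theorem 4.58] -/
theorem posDef_iff_real_and_injective (α : Fin n → ℂ) (σ : Equiv.Perm (Fin n))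
    (hσ : ∀ i, α (σ i) = starRingEnd ℂ (α i)) (H : Matrix (Fin n) (Fin n) ℝ)
    (hH : ∀ j k, ((H j k : ℝ) : ℂ) = ∑ i, α i ^ ((j : ℕ) + (k : ℕ))) :
    H.PosDef ↔ (∀ i, (α i).im = 0) ∧ Function.Injective α := by
  constructor
  · exact im_eq_zero_and_injective_of_posDef α σ hσ H hH
  · rintro ⟨him, hinj⟩
    -- `α = β` coerced, `β` real and injective, and `H = newtonHankel β`
    let β : Fin n → ℝ := fun i => (α i).re
    have hβ : ∀ i, ((β i : ℝ) : ℂ) = α i := fun i =>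
      Complex.ext (by simp [β]) (by simp [β, him i])
    have hβinj : Function.Injective β := fun i j h => hinj (by rw [← hβ i, ← hβ j, h])
    have hHβ : H = newtonHankel β := by
      ext j k
      apply Complex.ofReal_injective
      rw [hH, newtonHankel_apply]
      push_cast
      simp [hβ]
    rw [hHβ]
    exact posDef_newtonHankel_of_injective β hβinj

/-- **The criterion for a real polynomial** (how a finite-level certificate is read): let
`p ∈ ℝ[X]` have degree `n`, let `N_m = Σ_{x} x^m` be its Newton sums over the complex roots
counted with multiplicity, and let `H = (N_{j+k})_{0 ≤ j,k < n}` (a real matrix).  If `H` is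
positive definite then every complex root of `p` is real and the roots are simple.
[cite: BasuPollackRoy2006, §4.3.2, Theorem 4.58] -/
theorem roots_im_eq_zero_and_nodup_of_posDef (p : Polynomial ℝ) {n : ℕ} (hn : p.natDegree = n)
    (H : Matrix (Fin n) (Fin n) ℝ)
    (hH : ∀ j k, ((H j k : ℝ) : ℂ) =
      ((p.map (algebraMap ℝ ℂ)).roots.map (fun x => x ^ ((j : ℕ) + (k : ℕ)))).sum)
    (hpos : H.PosDef) :
    (∀ x ∈ (p.map (algebraMap ℝ ℂ)).roots, x.im = 0) ∧ (p.map (algebraMap ℝ ℂ)).roots.Nodup := by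
  classical
  set q : Polynomial ℂ := p.map (algebraMap ℝ ℂ) with hq
  set s : Multiset ℂ := q.roots with hs
  have hinjRC : Function.Injective (algebraMap ℝ ℂ) := (algebraMap ℝ ℂ).injective
  have hcardq : Multiset.card s = q.natDegree := IsAlgClosed.card_roots_eq_natDegree
  have hcard : Multiset.card s = n := by
    rw [hcardq, hq, Polynomial.natDegree_map_eq_of_injective hinjRC, hn]
  -- the root multiset of a real polynomial is closed under complex conjugation
  have hconj : s.map (starRingEnd ℂ) = s := by
    have h1 : s.map (starRingEnd ℂ) = (q.map (starRingEnd ℂ)).roots :=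
      Polynomial.roots_map_of_injective_of_card_eq_natDegree (starRingEnd ℂ).injective hcardq
    have h2 : q.map (starRingEnd ℂ) = q := by
      rw [hq, Polynomial.map_map]
      congr 1
      ext x
      simp
    rw [h1, h2]
  -- enumerate the roots with multiplicity by `Fin n`
  have hcard' : Fintype.card s = n := by rw [Multiset.card_coe, hcard]
  let e : s ≃ Fin n := Fintype.equivFinOfCardEq hcard'
  let α : Fin n → ℂ := fun i => ((e.symm i : s) : ℂ)
  -- conjugation acts on the enumeration by a permutation
  let τ : s ≃ s := (s.mapEquiv (starRingEnd ℂ)).trans (Multiset.cast hconj)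
  have hτ : ∀ x : s, ((τ x : s) : ℂ) = starRingEnd ℂ (x : ℂ) := by
    intro x
    show (Multiset.cast hconj (s.mapEquiv (starRingEnd ℂ) x)).1 = _
    exact Multiset.mapEquiv_apply s (starRingEnd ℂ) x
  let σ : Equiv.Perm (Fin n) := (e.symm.trans τ).trans e
  have hσ : ∀ i, α (σ i) = starRingEnd ℂ (α i) := by
    intro i
    simp only [α, σ, Equiv.trans_apply, Equiv.symm_apply_apply, hτ]
  -- Newton sums as sums over the enumeration
  have hsum : ∀ t : ℕ, ∑ i, α i ^ t = (s.map (fun x => x ^ t)).sum := by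
    intro t
    have h1 : ∑ i, α i ^ t = ∑ x : s, (x : ℂ) ^ t := Equiv.sum_comp e.symm (fun x : s => (x : ℂ) ^ t)
    rw [h1, Finset.sum_eq_multiset_sum, Multiset.map_univ s (fun x => x ^ t)]
  have hH' : ∀ j k, ((H j k : ℝ) : ℂ) = ∑ i, α i ^ ((j : ℕ) + (k : ℕ)) := fun j k => by
    rw [hH, hsum]
  obtain ⟨him, hinj⟩ := im_eq_zero_and_injective_of_posDef α σ hσ H hH' hpos
  refine ⟨fun x hx => ?_, ?_⟩
  · let y : s := s.mkToType x ⟨0, Multiset.count_pos.mpr hx⟩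
    have hi : α (e y) = x := by
      show ((e.symm (e y) : s) : ℂ) = x
      rw [Equiv.symm_apply_apply]
    rw [← hi]
    exact him _
  · rw [Multiset.nodup_iff_count_le_one]
    intro a
    by_contra hlt
    push Not at hlt
    let y0 : s := s.mkToType a ⟨0, by omega⟩
    let y1 : s := s.mkToType a ⟨1, by omega⟩
    have hne : y0 ≠ y1 := by
      intro h
      have := congrArg (fun y : s => (y.2 : ℕ)) h
      simp [y0, y1] at this
    have heq : α (e y0) = α (e y1) := by
      show ((e.symm (e y0) : s) : ℂ) = ((e.symm (e y1) : s) : ℂ)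
      rw [Equiv.symm_apply_apply, Equiv.symm_apply_apply]
    exact hne (e.injective (hinj heq))

end HermiteRootCounting

end Literature.LinearAlgebra.Matrix
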